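import Summits.KontsevichZagierPeriods.KontsevichZagierPeriods.Theorems.RootDecompWalshStrataAffineDescent01
import Summits.KontsevichZagierPeriods.KontsevichZagierPeriods.Theorems.RootDecompWalshStrataQuadDescent01

/-!
# Quadratic descent, part 2/3: conic families, the cubic potential `Φ_w` and the conic section lemma

Declarations `Conic.pxyP` … `InBaker.conic_section3` of the farm-checked gen-7 file (namespace `…ConicDescent`): a conic
as a polynomial over `ℚ`, its coefficient `Polynomial`s `BX CX DX`, the sections `secP3` / `secN3` of the cubic
potential at a root branch and the identity `Conic.root_value3`, sign atoms `atomFam` of a conic family, the potential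
`quadΦ` (`∂Φ_w/∂y = w`), the root piece `InBaker.conic_root_piece3` and `InBaker.conic_section3`.
See the module docstring of `RootDecompWalshStrataQuadDescent01` (part 1) for the overview and the sources.
[KontsevichZagier2001 §1.2; BCR1998 §2.2; this node gen 7]
-/

noncomputable section

open Literature.NumberTheory.Transcendental
open MeasureTheory Set
open MvPolynomial (aeval X C)
open Literature.ModelTheory.ExponentialFields (IsSemialgebraic isSemialgebraic_univ
  isSemialgebraic_setOf_eval_pos isSemialgebraic_setOf_eval_lt isSemialgebraic_setOf_eval_le
  isSemialgebraic_setOf_eval_nonneg isSemialgebraic_setOf_eval_eq_zero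
  isSemialgebraic_setOf_eval_ne_zero continuous_aeval_real tarski_seidenberg_real_holds)

namespace Summit.KontsevichZagierPeriods.RootDecompWalshStrata.ConicDescent

/-! #### 27.3 Conics as polynomials; sign atoms of a conic family -/

namespace Conic

variable (Q : Conic)

/-- The conic `p(x, y)` as a two-variable polynomial over `ℚ`. -/
def pxyP : MvPolynomial (Fin 2) ℚ :=
  C Q.A * X 1 ^ 2 + (C Q.b0 + C Q.b1 * X 0) * X 1 + (C Q.c0 + C Q.c1 * X 0 + C Q.c2 * X 0 ^ 2)

/-- Evaluation of `pxyP` is `pxy`. [this node] -/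
@[simp] theorem aeval_pxyP (v : Fin 2 → ℝ) : aeval v Q.pxyP = Q.pxy (v 0) (v 1) := by
  simp only [pxyP, pxy, Bx, Cx, map_add, map_mul, map_pow, MvPolynomial.aeval_C, MvPolynomial.aeval_X,
    eq_ratCast]

/-- `(x, y) ↦ p(x, y)` is continuous. [folklore] -/
theorem continuous_pxy : Continuous fun v : Fin 2 → ℝ => Q.pxy (v 0) (v 1) :=
  (continuous_aeval_real Q.pxyP).congr fun v => Q.aeval_pxyP v

/-- `B(x)` as a one-variable `Polynomial` (the terminals take `Polynomial ℚ`). -/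
def BX : Polynomial ℚ := Polynomial.C Q.b0 + Polynomial.C Q.b1 * Polynomial.X

/-- `C(x)` as a one-variable `Polynomial`. -/
def CX : Polynomial ℚ :=
  Polynomial.C Q.c0 + Polynomial.C Q.c1 * Polynomial.X + Polynomial.C Q.c2 * Polynomial.X ^ 2

/-- `D(x) = B² − 4AC` as a one-variable `Polynomial`. -/
def DX : Polynomial ℚ := Q.BX ^ 2 - 4 * Polynomial.C Q.A * Q.CX

/-- Evaluation of `BX`. [this node] -/
@[simp] theorem aeval_BX (x : ℝ) : Polynomial.aeval x Q.BX = Q.Bx x := by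
  simp only [BX, Bx, map_add, map_mul, Polynomial.aeval_C, Polynomial.aeval_X, eq_ratCast]

/-- Evaluation of `CX`. [this node] -/
@[simp] theorem aeval_CX (x : ℝ) : Polynomial.aeval x Q.CX = Q.Cx x := by
  simp only [CX, Cx, map_add, map_mul, map_pow, Polynomial.aeval_C, Polynomial.aeval_X, eq_ratCast]

/-- Evaluation of `DX`. [this node] -/
@[simp] theorem aeval_DX (x : ℝ) : Polynomial.aeval x Q.DX = Q.Dx x := by
  simp only [DX, Dx, map_sub, map_mul, map_pow, map_ofNat, Polynomial.aeval_C, eq_ratCast, aeval_BX,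
    aeval_CX]

/-- The polynomial part `P₁ = −C_w B/(2A) + B_w (B² + D)/(8A²) − A_w (B³ + 3BD)/(24A³)` of the cubic
potential `Φ_w` at a root of `Q`. -/
def secP3 (w : Conic) : MvPolynomial (Fin 1) ℚ :=
  -w.Cp * Q.Bp * C (1 / (2 * Q.A)) + C (1 / (8 * Q.A ^ 2)) * w.Bp * (Q.Bp ^ 2 + Q.Dp) -
    C (w.A / (24 * Q.A ^ 3)) * (Q.Bp ^ 3 + 3 * Q.Bp * Q.Dp)

/-- Evaluation of `secP3`. [this node] -/
theorem aeval_secP3 (w : Conic) (v : Fin 1 → ℝ) :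
    aeval v (Q.secP3 w) = -w.Cx (v 0) * Q.Bx (v 0) / (2 * Q.A) +
      w.Bx (v 0) * (Q.Bx (v 0) ^ 2 + Q.Dx (v 0)) / (8 * Q.A ^ 2) -
      (w.A : ℝ) * (Q.Bx (v 0) ^ 3 + 3 * Q.Bx (v 0) * Q.Dx (v 0)) / (24 * Q.A ^ 3) := by
  simp only [secP3, map_add, map_sub, map_mul, map_neg, map_pow, map_ofNat, MvPolynomial.aeval_C,
    aeval_Bp, aeval_Cp, aeval_Dp, eq_ratCast]
  push_cast
  ring

/-- The square-root coefficient `s·N`, `N = C_w/(2A) − B_w B/(4A²) + A_w (3B² + D)/(24A³)` (a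
`Polynomial` of degree `≤ 2`), of `Φ_w` at the root `(−B + s√D)/(2A)` of `Q`. -/
def secN3 (w : Conic) (s : ℚ) : Polynomial ℚ :=
  Polynomial.C s * (Polynomial.C (1 / (2 * Q.A)) * w.CX -
    Polynomial.C (1 / (4 * Q.A ^ 2)) * w.BX * Q.BX +
    Polynomial.C (w.A / (24 * Q.A ^ 3)) * (3 * Q.BX ^ 2 + Q.DX))

/-- Evaluation of `secN3`. [this node] -/
theorem aeval_secN3 (w : Conic) (s : ℚ) (x : ℝ) :
    Polynomial.aeval x (Q.secN3 w s) = (s : ℝ) * (w.Cx x / (2 * Q.A) -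
      w.Bx x * Q.Bx x / (4 * Q.A ^ 2) + (w.A : ℝ) * (3 * Q.Bx x ^ 2 + Q.Dx x) / (24 * Q.A ^ 3)) := by
  simp only [secN3, map_add, map_sub, map_mul, map_pow, map_ofNat, Polynomial.aeval_C, eq_ratCast,
    aeval_BX, aeval_CX, aeval_DX]
  push_cast
  ring

/-- **ROOT VALUE IDENTITY (cubic potential).**  For `y = (−B + s u)/(2A)` with `s² = 1`, `u² = D`:
`c_w y + (b_w/2) y² + (a_w/3) y³ = P₁ + N·(s u)` with
`P₁ = −c_w B/(2A) + b_w (B² + D)/(8A²) − a_w (B³ + 3BD)/(24A³)`,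
`N = c_w/(2A) − b_w B/(4A²) + a_w (3B² + D)/(24A³)`. [folklore] -/
theorem root_value3 (A B D cw bw aw s u : ℝ) (hs : s * s = 1) (hu : u ^ 2 = D) :
    cw * ((-B + s * u) / (2 * A)) + bw / 2 * ((-B + s * u) / (2 * A)) ^ 2 +
        aw / 3 * ((-B + s * u) / (2 * A)) ^ 3 =
      (-cw * B / (2 * A) + bw * (B ^ 2 + D) / (8 * A ^ 2) - aw * (B ^ 3 + 3 * B * D) / (24 * A ^ 3)) +
        (cw / (2 * A) - bw * B / (4 * A ^ 2) + aw * (3 * B ^ 2 + D) / (24 * A ^ 3)) * (s * u) := by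
  linear_combination (u ^ 2 * (bw / (8 * A ^ 2) + aw * (s * u - 3 * B) / (24 * A ^ 3))) * hs +
    (bw / (8 * A ^ 2) + aw * (s * u - 3 * B) / (24 * A ^ 3)) * hu

end Conic

/-- SIGN ATOM of a finite family of conics `F` with sign vector `σ` inside the open unit square. -/
def atomFam {k : ℕ} (F : Fin k → Conic) (σ : Fin k → SignType) : Set (Fin 2 → ℝ) :=
  {v | (∀ j, 0 < v j ∧ v j < 1) ∧ ∀ i, SignType.sign ((F i).pxy (v 0) (v 1)) = σ i}

/-! #### 27.4 The cubic potential `Φ_w = C_w(x) y + B_w(x) y²/2 + A_w y³/3` and its sections along conic roots -/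

/-- The potential `Φ_w` with `∂Φ_w/∂y = w(x, y)`, as a polynomial over `ℚ`. -/
def quadΦ (w : Conic) : MvPolynomial (Fin 2) ℚ :=
  (C w.c0 + C w.c1 * X 0 + C w.c2 * X 0 ^ 2) * X 1 + C (1 / 2) * (C w.b0 + C w.b1 * X 0) * X 1 ^ 2 +
    C (w.A / 3) * X 1 ^ 3

/-- Evaluation of `quadΦ`. [this node] -/
theorem aeval_quadΦ (w : Conic) (z : Fin 2 → ℝ) :
    aeval z (quadΦ w) = w.Cx (z 0) * z 1 + w.Bx (z 0) / 2 * z 1 ^ 2 + (w.A : ℝ) / 3 * z 1 ^ 3 := by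
  simp only [quadΦ, Conic.Cx, Conic.Bx, map_add, map_mul, map_pow, MvPolynomial.aeval_C,
    MvPolynomial.aeval_X, eq_ratCast]
  push_cast
  ring

/-- Evaluation of `quadΦ` at a point `(x, t)` of a fibre (over `Fin (1 + 1)`, the index type the
planar-sections engine produces at `N = 1`). [this node] -/
theorem aeval_quadΦ_snoc (w : Conic) (x : Fin 1 → ℝ) (t : ℝ) :
    aeval (Fin.snoc x t : Fin (1 + 1) → ℝ) (quadΦ w) =
      w.Cx (x 0) * t + w.Bx (x 0) / 2 * t ^ 2 + (w.A : ℝ) / 3 * t ^ 3 := by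
  rw [aeval_quadΦ]; rfl

/-- **ROOT PIECE (cubic potential).**  On `T ⊆ [0,1]` with `ζ = (−B + s√D)/(2A)` (`s = ±1`, `D ≥ 0`):
`[T, Φ_w(x, ζ)] = [T, P₁] + [T, (sN)·√D]`, `deg N ≤ 2` — polynomial part by rule (1), square-root part by
`InBaker.poly_sqrt`. [this node] -/
theorem InBaker.conic_root_piece3 (Q w : Conic) (s : ℚ) (hs : s * s = 1)
    (r : KZ.IntegralRep 1) (hI : r.domain ⊆ Icc 0 1) (ζ : (Fin 1 → ℝ) → ℝ)
    (hD : ∀ v ∈ r.domain, 0 ≤ Q.Dx (v 0))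
    (hζ : ∀ v ∈ r.domain, ζ v = (-Q.Bx (v 0) + s * √(Q.Dx (v 0))) / (2 * Q.A))
    (hr : EqOn r.integrand
      (fun v => w.Cx (v 0) * ζ v + w.Bx (v 0) / 2 * ζ v ^ 2 + (w.A : ℝ) / 3 * ζ v ^ 3) r.domain) :
    InBaker (KZ.of r) := by
  refine InBaker.of_sub' r (polyRep₁ r.domain r.isSemialgebraic_domain hI (Q.secP3 w)) rfl
    (InBaker.of_eqOn_aeval _ (Q.secP3 w) fun v _ => rfl) ?_
  refine InBaker.poly_sqrt Q.e Q.f Q.g (Q.secN3 w s) _ hI fun v hv => ?_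
  have hv : v ∈ r.domain := hv
  have hu : √(Q.Dx (v 0)) ^ 2 = Q.Dx (v 0) := Real.sq_sqrt (hD v hv)
  have hs' : (s : ℝ) * s = 1 := by exact_mod_cast hs
  rw [subRep_integrand, polyRep₁_integrand, hr hv]
  beta_reduce
  rw [hζ v hv, qD, ← Q.Dx_eq, Q.aeval_secP3, Q.aeval_secN3, Conic.root_value3 _ _ _ _ _ _ _ _ hs' hu]
  ring

/-- **CONIC SECTION LEMMA (cubic potential).**  `Q` a conic over `ℚ` not identically zero, `T ⊆ [0,1]`
`ℚ`-semialgebraic, `ζ : T → ℝ` `ℚ`-semialgebraic with `Q(x, ζ x) = 0` on `T`; then `[T, Φ_w(x, ζ x)]`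
lies in the Baker sector: `A ≠ 0` — split by the root branch, `InBaker.conic_root_piece3`; `A = 0` — on
`{B ≠ 0}` `ζ = −C/B` and the integrand is rational (rule (1)), `{B = 0} ∩ T` is null unless `B ≡ 0`, then
`{C = 0} ∩ T` is null unless `C ≡ 0`, excluded. [KontsevichZagier2001 §1.2; this node] -/
theorem InBaker.conic_section3 (Q : Conic) (hQ : ∃ x y : ℝ, Q.pxy x y ≠ 0) (w : Conic)
    (r : KZ.IntegralRep 1) (hI : r.domain ⊆ Icc 0 1) (ζ : (Fin 1 → ℝ) → ℝ)
    (hζ : IsSemialgebraicFunOn ℚ r.domain ζ) (hroot : ∀ v ∈ r.domain, Q.pxy (v 0) (ζ v) = 0)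
    (hr : EqOn r.integrand
      (fun v => w.Cx (v 0) * ζ v + w.Bx (v 0) / 2 * ζ v ^ 2 + (w.A : ℝ) / 3 * ζ v ^ 3) r.domain) :
    InBaker (KZ.of r) := by
  classical
  by_cases hA : Q.A = 0
  · -- `p = B(x) y + C(x)`
    have hA' : (Q.A : ℝ) = 0 := by exact_mod_cast hA
    refine InBaker.of_cover r ![{v | aeval v Q.Bp ≠ 0}, {v | aeval v Q.Bp = 0}] ?_ ?_ ?_
    · intro i
      fin_cases i
      · exact isSemialgebraic_setOf_eval_ne_zero _
      · exact isSemialgebraic_setOf_eval_eq_zero _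
    · intro v _
      by_cases h : aeval v Q.Bp = 0
      · exact mem_iUnion.2 ⟨1, h⟩
      · exact mem_iUnion.2 ⟨0, h⟩
    · intro i T hT hTr hTA
      fin_cases i
      · -- `B ≠ 0` on `T`: rational integrand with denominator `B³`
        refine InBaker.of_eqOn_aeval_div _
          (-w.Cp * Q.Cp * Q.Bp ^ 2 + C (1 / 2) * w.Bp * Q.Cp ^ 2 * Q.Bp - C (w.A / 3) * Q.Cp ^ 3)
          (Q.Bp ^ 3) (fun v hv => by rw [map_pow]; exact pow_ne_zero _ (hTA hv)) fun v hv => ?_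
        have hB : Q.Bx (v 0) ≠ 0 := by simpa [Q.aeval_Bp] using (hTA hv : aeval v Q.Bp ≠ 0)
        have hz : ζ v = -Q.Cx (v 0) / Q.Bx (v 0) := by
          have h := hroot v (hTr hv)
          simp only [Conic.pxy, hA', zero_mul, zero_add] at h
          field_simp
          linarith
        rw [KZ.IntegralRep.integrand_restrict, hr (hTr hv)]
        beta_reduce
        rw [hz]
        simp only [map_add, map_sub, map_mul, map_neg, map_pow, MvPolynomial.aeval_C, Q.aeval_Bp,
          Q.aeval_Cp, w.aeval_Bp, w.aeval_Cp, eq_ratCast]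
        push_cast
        field_simp
        ring
      · -- `B = 0` on `T`, hence `C = 0` on `T`
        have hB : ∀ v ∈ T, Q.Bx (v 0) = 0 := fun v hv => by
          simpa [Q.aeval_Bp] using (hTA hv : aeval v Q.Bp = 0)
        have hC : ∀ v ∈ T, Q.Cx (v 0) = 0 := fun v hv => by
          have h := hroot v (hTr hv)
          simp only [Conic.pxy, hA', zero_mul, zero_add, hB v hv] at h
          exact h
        by_cases hb : Q.b0 = 0 ∧ Q.b1 = 0
        · by_cases hc : Q.c0 = 0 ∧ Q.c1 = 0 ∧ Q.c2 = 0
          · exfalso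
            obtain ⟨x, y, hxy⟩ := hQ
            apply hxy
            simp [Conic.pxy, Conic.Bx, Conic.Cx, hA, hb.1, hb.2, hc.1, hc.2.1, hc.2.2]
          · refine InBaker.of_subset_zeroSet _ Q.Cp ?_ fun v hv => by simpa [Q.aeval_Cp] using hC v hv
            by_contra hall
            exact hc (quad_coeffs_eq_zero _ _ _ fun x => by
              simpa [Q.aeval_Cp, Conic.Cx] using not_not.1 (not_exists.1 hall fun _ => x))
        · refine InBaker.of_subset_zeroSet _ Q.Bp ?_ fun v hv => (hTA hv : aeval v Q.Bp = 0)
          by_contra hall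
          have h := quad_coeffs_eq_zero Q.b0 Q.b1 0 fun x => by
            simpa [Q.aeval_Bp, Conic.Bx] using not_not.1 (not_exists.1 hall fun _ => x)
          exact hb ⟨h.1, h.2.1⟩
  · -- `A ≠ 0`: `ζ` is one of the two roots
    have hrt : ∀ v ∈ r.domain, 0 ≤ Q.Dx (v 0) ∧ (ζ v = Q.lox (v 0) ∨ ζ v = Q.hix (v 0)) :=
      fun v hv => Q.eq_root_of_eq_zero hA _ _ (hroot v hv)
    refine InBaker.of_cover r ![{v | v ∈ r.domain ∧ ζ v = Q.lox (v 0)},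
      {v | v ∈ r.domain ∧ ζ v = Q.hix (v 0)}] ?_ ?_ ?_
    · intro i
      fin_cases i
      · exact isSemialgebraic_sep_eq hζ (Q.isSemialgebraicFunOn_lox r.isSemialgebraic_domain)
      · exact isSemialgebraic_sep_eq hζ (Q.isSemialgebraicFunOn_hix r.isSemialgebraic_domain)
    · intro v hv
      rcases (hrt v hv).2 with h | h
      · exact mem_iUnion.2 ⟨0, hv, h⟩
      · exact mem_iUnion.2 ⟨1, hv, h⟩
    · intro i T hT hTr hTA
      fin_cases i
      · refine InBaker.conic_root_piece3 Q w 1 (by norm_num) _ (fun v hv => hI (hTr hv)) ζ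
          (fun v hv => (hrt v (hTr hv)).1) (fun v hv => ?_) fun v hv => hr (hTr hv)
        have h : ζ v = Q.lox (v 0) := (hTA hv : v ∈ r.domain ∧ ζ v = Q.lox (v 0)).2
        rw [h, Conic.lox]; push_cast; ring
      · refine InBaker.conic_root_piece3 Q w (-1) (by norm_num) _ (fun v hv => hI (hTr hv)) ζ
          (fun v hv => (hrt v (hTr hv)).1) (fun v hv => ?_) fun v hv => hr (hTr hv)
        have h : ζ v = Q.hix (v 0) := (hTA hv : v ∈ r.domain ∧ ζ v = Q.hix (v 0)).2
        rw [h, Conic.hix]; push_cast; ring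

end Summit.KontsevichZagierPeriods.RootDecompWalshStrata.ConicDescent
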